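import Summits.NavierStokesRegularity.FunctionalMining.NoGo.TopEigHeatTranslationAverage
import HarnessLib

/-!
# NO-GO K45 — CALIBRATION BY A TRANSLATION AVERAGE: if some convex combination of TRANSLATES of a field `v`
# with `Δv = −c₁v − z` equals the shifted field `v − τz` (`τ > 0`), then `v` is heat-coercive at the
# LOW-SHELL rate `q·c₁` (door (c), node K6, Lemma L-λ(q); static heat line `v + tΔv`, no transport, no pressure)

search for candidate a priori estimates; no regularity claim.

Cell `pub-nsfunc` (NS FUNCTIONAL MINING), NOGO seat (gen 50). A class-level structural statement about the
WITNESS SET of the wanted kill (F2) `¬ TopEigHeatCoercivePos q` of the heat-coercivity lemma L-λ(q)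
(`@[conjecture] TopEig.TopEigHeatCoercivePos q`; the tree's `heatDissipation`, `HeatCoerciveOn`). Nothing
about Navier–Stokes is proved or asserted; no node of the cell is decided (L-λ(q) stays OPEN in the kernel
for every real `q > 1`, FALSE at `q = 1`: K32 `NoGo/TopEigHeatCoerciveOne`).

SETTING (any nonempty finite `d`, every real `q ≥ 1`, both one-sided cores
`Φ_q ∈ {∫(λ₁⁺)^q, ∫((−λ₃)⁺)^q}`). `v, z` smooth with `Δv = −c₁v − z` (for a finite sum of Laplace
eigenfields `v = u + ∑ₖ wₖ`, `Δu = −c₁u`, `Δwₖ = −cₖwₖ`, this holds with `z = ∑ₖ (cₖ − c₁)wₖ`).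
DEFINITION (in words; the theorems carry it as a hypothesis). `v` is CALIBRATED if there are finitely many
translations `aⱼ`, weights `θⱼ ≥ 0` with `∑θⱼ = 1`, and `τ > 0` with
    `∑ⱼ θⱼ · v(· + aⱼ) = v − τ z`                                        (CAL)
— for `v = u + ∑ₖ wₖ` as above: the average fixes `u` and acts on the piece `wₖ` as the scalar
`1 − τ(cₖ − c₁)`, ONE common `τ` for all pieces.
THEOREM (`calibrated_coercive`; class form `heatCoerciveOn_calibrated_top/negBot`):
  **(CAL) ⇒ `q c₁ Φ_q(v) ≤ heatDissipation Φ_q v`** — coercive at the full LOW-SHELL rate, hence NOT a kill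
  witness for L-λ(q) at any rate `c ≤ q c₁` (`calibrated_not_kill`).
PROOF (kernel, five lines). JENSEN OVER TRANSLATES (K42 `topEigMoment_sum_smul_translate_le`: `Φ_q` is convex
on the smooth fields and translation invariant) gives `Φ_q(v − τz) = Φ_q(∑θⱼ v(· + aⱼ)) ≤ Φ_q(v)`; K39's shift
inequality (`TopEig.heatDissipation_topEigMoment_shift_ge`) is `q c₁ Φ_q(v) + (Φ_q(v) − Φ_q(v − τz))/τ ≤
heatDissipation Φ_q v`.
WHAT IT SUBSUMES. K42 (two shells, shifts fixing `u` whose `w`-translates cancel: the uniform average is `u =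
v − τz` with `τ(c₂ − c₁) = 1`) and K43 (independent sign flips `hⱼ`: the product of the two-point averages
`{0, hⱼ}` with weights `(1 − aⱼ, aⱼ)` acts on `wⱼ` as `1 − 2aⱼ`, tunable piece by piece) are calibrations.
WHAT IS NEW (instruction (i)/(iii): the typed DESIGN RULE for door-(c)/(F2) candidates in its natural
generality). Pieces WITHOUT any independent sign symmetry can still be calibrated by LINKED multipliers. The
instance proved here (`threeShell_symmetricPair_coercive`): `v = u + w₂ + w₃`, `Δu = −c₁u`, `Δwₖ = −cₖwₖ`,
`c₁ < c₂`, one translation `h` with `u(· + h) = u` and SYMMETRIC-PAIR relations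
`w₂(· + h) + w₂(· − h) = 2m₂·w₂`, `w₃(· + h) + w₃(· − h) = 2m₃·w₃`, `m₂ < 1`, linked by
`(1 − m₂)(c₃ − c₁) = (1 − m₃)(c₂ − c₁)`: then `½(v(· + h) + v(· − h)) = v − τz` with `τ = (1 − m₂)/(c₂ − c₁)`,
so `v` is coercive at `q c₁`. ON `T³` IN FOURIER TERMS (pen, not needed by the kernel): a real field whose
modes `ξ` all have `ξ·h ≡ ±θ (mod 1)` satisfies the pair relation with `m = cos 2πθ`. Example: `h = e₃/6`;
`u` = any eigenfield of the shell `|ξ|² = 1` with `ξ₃ = 0`; `w₂` = any eigenfield of the shell `|ξ|² = 2` with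
`|ξ₃| = 1` (`m₂ = cos(π/3) = ½`); `w₃` = any eigenfield of the shell `|ξ|² = 4` with `|ξ₃| = 2` (a shear in
`x₃`, `m₃ = cos(2π/3) = −½`); the link holds since `(c₃ − c₁) = 3(c₂ − c₁)` (`cₖ = 4π²·{1, 2, 4}`). As soon as
`w₂` contains two modes `ξ, ξ'` with `ξ − ξ' = ±2e₃` (e.g. `(1,0,1)` and `(1,0,−1)`), NO translation `g` flips
`w₃` while fixing `w₂` (it would need `2g₃ ∈ ½ + ℤ` and `2g₃ = g·(ξ − ξ') ∈ ℤ`), so K43 is silent, and K42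
does not apply (three shells); K45 gives coercivity at `q·4π²` for every real `q ≥ 1`, all amplitudes and
phases. The general symmetric-pair form (`symmetricPair_coercive`: `u(· + h) = u` is not even needed, only
`v(· + h) + v(· − h) = 2(v − τz)`) covers any number of pieces `wₖ` whose modes have `ξ·h ≡ ±θₖ (mod 1)` with
`cos 2πθₖ = 1 − τ(cₖ − c₁)` for one common `τ > 0`.
THE GENERAL CRITERION (pen; Bochner). For `v = u + ∑ₖ wₖ` on `T³` write `Uₖ ⊂ ℤ³` for the frequency
support of piece `k` (`U₁` that of `u`). `v` is calibrated iff there are a probability measure `p` on `T³`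
(finitely supported) and `τ > 0` whose Fourier transform satisfies `p̂ ≡ 1` on `U₁` and `p̂ ≡ 1 − τ(cₖ − c₁)`
on `Uₖ` — an AFFINE profile in the eigenvalue `cₖ`, decreasing from `1`. DESIGN RULE FOR (F2): a candidate
family must be NON-CALIBRATED for every `τ > 0`, i.e. must live where no such `p` exists — e.g. all pieces
commensurate with `u` (`Uₖ ⊂ span_ℤ U₁`: then `p̂ ≡ 1` is forced on every `Uₖ`, K42's rule), or multiplier
profiles that are not jointly realisable by a positive-definite function (for one translation direction and
two pieces with `|ξ₃| ∈ {1, 2}` the realisable pairs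
`(E cos ϑ, E cos 2ϑ)` fill `{(x, y) : 2x² − 1 ≤ y ≤ 1}`, and the affine ray `(1 − τa, 1 − τb)`, `a = c₂ − c₁`,
`b = c₃ − c₁`, enters it for small `τ > 0` iff `b < 4a`: along that axis only piece pairs with
`c₃ − c₁ ≥ 4(c₂ − c₁)` escape this particular family of calibrations). With K44 (sharp `N_q`-thresholds) and K42/K43 this is the current
typed description of where a door-(c) kill can live. NO CLAIM that non-calibrated fields kill.
HONEST LIMITS. Static statement about the heat line `t ↦ v + tΔv` of the convex cores `Φ_q`; it says nothing
about Leray–Hopf solutions, transport or pressure, and nothing about L-λ(q) itself beyond "these fields are not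
counterexamples at rates `≤ q c₁`".

Imports: K42 `NoGo/TopEigHeatTranslationAverage` (Jensen over translates, translation invariance; it imports
K39 `NoGo/TopEigHeatTwoShell`: the shift inequalities). [ours, calibration; Jensen = Mathlib
`ConvexOn.map_sum_le` inside K42]
search for candidate a priori estimates; no regularity claim.
FILING (prove seat g29, REQUEST #71): declarations byte-identical to the no-go seat's staged `TopEigHeatTranslationCalibrated.STAGING.lean` 47a6a241b7b83153; this line is the only addition.
-/

noncomputable section

open MeasureTheory Set Filter Topology

namespace Summit.NavierStokesRegularity.FunctionalMining

open Literature.Analysis.FunctionSpaces Literature.Analysis.FluidPDE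

namespace TopEig

variable {d : Type*} [Fintype d] [DecidableEq d]

/-! ## 1. Calibrated fields are coercive at the low-shell rate -/

section Calibrated

variable [Nonempty d] {q c₁ : ℝ} {ι : Type*} {v z : UnitAddTorus d → EuclideanSpace ℝ d}

/-- **THE CALIBRATION STEP (both cores)**: if a convex combination of translates of the smooth field `v`
equals `v − τz`, then `Φ_q(v − τz) ≤ Φ_q(v)` (`q ≥ 1`). [ours, calibration; Jensen over translates, K42] -/
theorem calibrated_moment_le (hq : 1 ≤ q) (hv : Torus.IsSmooth v) {s : Finset ι} {θ : ι → ℝ}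
    {a : ι → UnitAddTorus d} (h0 : ∀ j ∈ s, 0 ≤ θ j) (h1 : ∑ j ∈ s, θ j = 1) {τ : ℝ}
    (hcal : (∑ j ∈ s, θ j • fun y => v (y + a j)) = v + τ • (-z)) :
    torusTopEigMoment q (v + τ • (-z)) ≤ torusTopEigMoment q v ∧
      torusNegBotEigMoment q (v + τ • (-z)) ≤ torusNegBotEigMoment q v := by
  have j1 := topEigMoment_sum_smul_translate_le hq hv s θ a h0 h1
  have j2 := negBotEigMoment_sum_smul_translate_le hq hv s θ a h0 h1
  rw [hcal] at j1 j2
  exact ⟨j1, j2⟩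

/-- **K45 — A CALIBRATED FIELD IS COERCIVE AT THE LOW-SHELL RATE (both cores).** `v, z` smooth,
`Δv = −c₁v − z`, `q ≥ 1`; translations `aⱼ`, weights `θⱼ ≥ 0`, `∑θⱼ = 1`, `τ > 0` with
`∑ⱼ θⱼ v(· + aⱼ) = v − τz`. Then `q c₁ Φ_q(v) ≤ heatDissipation Φ_q v` for `Φ_q ∈ {∫(λ₁⁺)^q, ∫((−λ₃)⁺)^q}`.
[ours, calibration; K39 shift inequality + Jensen over translates] -/
theorem calibrated_coercive (hq : 1 ≤ q) (hv : Torus.IsSmooth v) (hz : Torus.IsSmooth z)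
    (hΔ : Torus.laplacian v = -(c₁ • v) - z) {s : Finset ι} {θ : ι → ℝ} {a : ι → UnitAddTorus d}
    (h0 : ∀ j ∈ s, 0 ≤ θ j) (h1 : ∑ j ∈ s, θ j = 1) {τ : ℝ} (hτ : 0 < τ)
    (hcal : (∑ j ∈ s, θ j • fun y => v (y + a j)) = v + τ • (-z)) :
    q * c₁ * torusTopEigMoment q v ≤ heatDissipation (torusTopEigMoment q) v ∧
      q * c₁ * torusNegBotEigMoment q v ≤ heatDissipation (torusNegBotEigMoment q) v := by
  obtain ⟨j1, j2⟩ := calibrated_moment_le (z := z) hq hv h0 h1 hcal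
  have g1 := heatDissipation_topEigMoment_shift_ge hq hv hz hΔ hτ
  have g2 := heatDissipation_negBotEigMoment_shift_ge hq hv hz hΔ hτ
  have p1 : 0 ≤ (torusTopEigMoment q v - torusTopEigMoment q (v + τ • (-z))) / τ :=
    div_nonneg (sub_nonneg.mpr j1) hτ.le
  have p2 : 0 ≤ (torusNegBotEigMoment q v - torusNegBotEigMoment q (v + τ • (-z))) / τ :=
    div_nonneg (sub_nonneg.mpr j2) hτ.le
  exact ⟨by linarith, by linarith⟩

/-- **NO KILL FROM A CALIBRATED FIELD (both cores)**: under (CAL), `v` is not a kill witness for L-λ(q) at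
any rate `c ≤ q c₁`. [ours, calibration] -/
theorem calibrated_not_kill (hq : 1 ≤ q) (hv : Torus.IsSmooth v) (hz : Torus.IsSmooth z)
    (hΔ : Torus.laplacian v = -(c₁ • v) - z) {s : Finset ι} {θ : ι → ℝ} {a : ι → UnitAddTorus d}
    (h0 : ∀ j ∈ s, 0 ≤ θ j) (h1 : ∑ j ∈ s, θ j = 1) {τ : ℝ} (hτ : 0 < τ)
    (hcal : (∑ j ∈ s, θ j • fun y => v (y + a j)) = v + τ • (-z)) {c : ℝ} (hc : c ≤ q * c₁) :
    ¬ heatDissipation (torusTopEigMoment q) v < c * torusTopEigMoment q v ∧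
      ¬ heatDissipation (torusNegBotEigMoment q) v < c * torusNegBotEigMoment q v := by
  obtain ⟨k1, k2⟩ := calibrated_coercive hq hv hz hΔ h0 h1 hτ hcal
  have m1 := mul_le_mul_of_nonneg_right hc (torusTopEigMoment_nonneg q v)
  have m2 := mul_le_mul_of_nonneg_right hc (torusNegBotEigMoment_nonneg q v)
  exact ⟨fun hlt => by linarith, fun hlt => by linarith⟩

/-- **THE SYMMETRIC-PAIR CALIBRATION (both cores)**: `v, z` smooth, `Δv = −c₁v − z`, `q ≥ 1`, and ONE
translation `h` with `v(· + h) + v(· − h) = 2(v − τz)`, `τ > 0`. Then `q c₁ Φ_q(v) ≤ heatDissipation Φ_q v`.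
(On `T³`: every piece `wₖ` of `v = u + ∑ₖ wₖ` has all its modes `ξ` with `ξ·h ≡ ±θₖ (mod 1)` and
`cos 2πθₖ = 1 − τ(cₖ − c₁)`; `θ₁ = 0` for `u`.) [ours, calibration] -/
theorem symmetricPair_coercive (hq : 1 ≤ q) (hv : Torus.IsSmooth v) (hz : Torus.IsSmooth z)
    (hΔ : Torus.laplacian v = -(c₁ • v) - z) (h : UnitAddTorus d) {τ : ℝ} (hτ : 0 < τ)
    (hpair : ((fun y => v (y + h)) + fun y => v (y - h)) = (2 : ℝ) • (v + τ • (-z))) :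
    q * c₁ * torusTopEigMoment q v ≤ heatDissipation (torusTopEigMoment q) v ∧
      q * c₁ * torusNegBotEigMoment q v ≤ heatDissipation (torusNegBotEigMoment q) v := by
  refine calibrated_coercive hq hv hz hΔ (s := (Finset.univ : Finset Bool)) (θ := fun _ => (1 / 2 : ℝ))
    (a := fun b => cond b h (-h)) (fun _ _ => by norm_num) (by rw [Fintype.sum_bool]; norm_num) hτ ?_
  rw [Fintype.sum_bool]
  simp only [cond_true, cond_false, ← sub_eq_add_neg]
  rw [← smul_add, hpair, smul_smul]
  norm_num

end Calibrated

/-! ## 2. The linked symmetric-pair instance: three shells, one translation, no sign symmetry needed -/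

section ThreeShell

variable [Nonempty d] {q c₁ c₂ c₃ m₂ m₃ : ℝ} {u w₂ w₃ : UnitAddTorus d → EuclideanSpace ℝ d}

omit [Nonempty d] in
/-- `Δ(u + w₂ + w₃) = −c₁(u + w₂ + w₃) − ((c₂ − c₁)w₂ + (c₃ − c₁)w₃)` for Laplace eigenfields.
[bookkeeping] -/
theorem laplacian_threeShell (hu : Torus.IsSmooth u) (hw₂ : Torus.IsSmooth w₂) (hw₃ : Torus.IsSmooth w₃)
    (hΔu : Torus.laplacian u = -(c₁ • u)) (hΔ₂ : Torus.laplacian w₂ = -(c₂ • w₂))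
    (hΔ₃ : Torus.laplacian w₃ = -(c₃ • w₃)) :
    Torus.laplacian (u + w₂ + w₃) = -(c₁ • (u + w₂ + w₃)) - ((c₂ - c₁) • w₂ + (c₃ - c₁) • w₃) := by
  funext x
  rw [Literature.Analysis.FunctionSpaces.Torus.laplacian_add_apply (hu.add hw₂) hw₃,
    Literature.Analysis.FunctionSpaces.Torus.laplacian_add_apply hu hw₂, hΔu, hΔ₂, hΔ₃]
  simp only [Pi.neg_apply, Pi.smul_apply, Pi.sub_apply, Pi.add_apply, smul_add, sub_smul]
  module

omit [Fintype d] [DecidableEq d] [Nonempty d] in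
/-- **THE SYMMETRIC PAIR CALIBRATES**: with `u(· + h) = u`, `w₂(· + h) + w₂(· − h) = 2m₂·w₂`,
`w₃(· + h) + w₃(· − h) = 2m₃·w₃`, `c₁ ≠ c₂` and the link `(1 − m₂)(c₃ − c₁) = (1 − m₃)(c₂ − c₁)`:
`½(v(· + h) + v(· − h)) = v − τz` for `v = u + w₂ + w₃`, `z = (c₂ − c₁)w₂ + (c₃ − c₁)w₃`,
`τ = (1 − m₂)/(c₂ − c₁)`. [ours, bookkeeping] -/
theorem symmetricPair_calibrates (h12 : c₁ ≠ c₂) (h : UnitAddTorus d) (hper : (fun y => u (y + h)) = u)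
    (hpair₂ : ((fun y => w₂ (y + h)) + fun y => w₂ (y - h)) = (2 * m₂) • w₂)
    (hpair₃ : ((fun y => w₃ (y + h)) + fun y => w₃ (y - h)) = (2 * m₃) • w₃)
    (hlink : (1 - m₂) * (c₃ - c₁) = (1 - m₃) * (c₂ - c₁)) :
    (∑ b ∈ (Finset.univ : Finset Bool), (fun _ : Bool => (1 / 2 : ℝ)) b •
        fun y => (u + w₂ + w₃) (y + cond b h (-h))) =
      (u + w₂ + w₃) + ((1 - m₂) / (c₂ - c₁)) • (-((c₂ - c₁) • w₂ + (c₃ - c₁) • w₃)) := by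
  have hc : c₂ - c₁ ≠ 0 := sub_ne_zero.mpr (Ne.symm h12)
  have hs2 : (1 / 2 : ℝ) * (2 * m₂) = 1 - (1 - m₂) / (c₂ - c₁) * (c₂ - c₁) := by
    field_simp; ring
  have hs3 : (1 / 2 : ℝ) * (2 * m₃) = 1 - (1 - m₂) / (c₂ - c₁) * (c₃ - c₁) := by
    have e : (1 - m₂) / (c₂ - c₁) * (c₃ - c₁) = 1 - m₃ := by
      rw [div_mul_eq_mul_div, hlink, mul_div_cancel_right₀ _ hc]
    rw [e]; ring
  rw [Fintype.sum_bool]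
  funext y
  have eu1 : u (y + h) = u y := congrFun hper y
  have eu2 : u (y - h) = u y := by
    have e := congrFun hper (y - h)
    simp only [sub_add_cancel] at e
    exact e.symm
  have e2 : w₂ (y + h) + w₂ (y - h) = (2 * m₂) • w₂ y := by
    have e := congrFun hpair₂ y; simpa only [Pi.add_apply, Pi.smul_apply] using e
  have e3 : w₃ (y + h) + w₃ (y - h) = (2 * m₃) • w₃ y := by
    have e := congrFun hpair₃ y; simpa only [Pi.add_apply, Pi.smul_apply] using e
  simp only [Pi.add_apply, Pi.smul_apply, Pi.neg_apply, cond_true, cond_false, ← sub_eq_add_neg]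
  rw [eu1, eu2]
  calc (1 / 2 : ℝ) • (u y + w₂ (y + h) + w₃ (y + h)) + (1 / 2 : ℝ) • (u y + w₂ (y - h) + w₃ (y - h))
      = u y + (1 / 2 : ℝ) • (w₂ (y + h) + w₂ (y - h)) + (1 / 2 : ℝ) • (w₃ (y + h) + w₃ (y - h)) := by
        module
    _ = u y + ((1 / 2 : ℝ) * (2 * m₂)) • w₂ y + ((1 / 2 : ℝ) * (2 * m₃)) • w₃ y := by
        rw [e2, e3, smul_smul, smul_smul]
    _ = u y + (1 - (1 - m₂) / (c₂ - c₁) * (c₂ - c₁)) • w₂ y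
          + (1 - (1 - m₂) / (c₂ - c₁) * (c₃ - c₁)) • w₃ y := by rw [hs2, hs3]
    _ = u y + w₂ y + w₃ y + ((1 - m₂) / (c₂ - c₁)) • -((c₂ - c₁) • w₂ y + (c₃ - c₁) • w₃ y) := by
        module

/-- **K45 INSTANCE — THREE SHELLS LINKED BY ONE SYMMETRIC TRANSLATION PAIR ARE COERCIVE AT THE LOW-SHELL
RATE (both cores).** `Δu = −c₁u`, `Δw₂ = −c₂w₂`, `Δw₃ = −c₃w₃`, `c₁ < c₂`, `q ≥ 1`; one translation `h`
with `u(· + h) = u`, `w₂(· + h) + w₂(· − h) = 2m₂·w₂`, `w₃(· + h) + w₃(· − h) = 2m₃·w₃`, `m₂ < 1`, and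
`(1 − m₂)(c₃ − c₁) = (1 − m₃)(c₂ − c₁)`. Then `q c₁ Φ_q(u + w₂ + w₃) ≤ heatDissipation Φ_q (u + w₂ + w₃)`.
No sign symmetry of `w₃` is assumed (K43 silent; e.g. shells `4π²·{1, 2, 4}` along `e₃`, `h = e₃/6`,
`m₂ = ½`, `m₃ = −½`, module docstring). [ours, calibration] -/
theorem threeShell_symmetricPair_coercive (hq : 1 ≤ q) (h12 : c₁ < c₂) (hu : Torus.IsSmooth u)
    (hw₂ : Torus.IsSmooth w₂) (hw₃ : Torus.IsSmooth w₃) (hΔu : Torus.laplacian u = -(c₁ • u))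
    (hΔ₂ : Torus.laplacian w₂ = -(c₂ • w₂)) (hΔ₃ : Torus.laplacian w₃ = -(c₃ • w₃)) (h : UnitAddTorus d)
    (hper : (fun y => u (y + h)) = u)
    (hpair₂ : ((fun y => w₂ (y + h)) + fun y => w₂ (y - h)) = (2 * m₂) • w₂)
    (hpair₃ : ((fun y => w₃ (y + h)) + fun y => w₃ (y - h)) = (2 * m₃) • w₃) (hm₂ : m₂ < 1)
    (hlink : (1 - m₂) * (c₃ - c₁) = (1 - m₃) * (c₂ - c₁)) :
    q * c₁ * torusTopEigMoment q (u + w₂ + w₃) ≤ heatDissipation (torusTopEigMoment q) (u + w₂ + w₃) ∧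
      q * c₁ * torusNegBotEigMoment q (u + w₂ + w₃) ≤
        heatDissipation (torusNegBotEigMoment q) (u + w₂ + w₃) := by
  have hz : Torus.IsSmooth ((c₂ - c₁) • w₂ + (c₃ - c₁) • w₃) :=
    (Torus.IsSmooth.smul _ hw₂).add (Torus.IsSmooth.smul _ hw₃)
  have hτ : 0 < (1 - m₂) / (c₂ - c₁) := div_pos (by linarith) (by linarith)
  exact calibrated_coercive hq ((hu.add hw₂).add hw₃) hz (laplacian_threeShell hu hw₂ hw₃ hΔu hΔ₂ hΔ₃)
    (s := (Finset.univ : Finset Bool)) (θ := fun _ => (1 / 2 : ℝ)) (fun _ _ => by norm_num)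
    (by rw [Fintype.sum_bool]; norm_num) hτ (symmetricPair_calibrates h12.ne h hper hpair₂ hpair₃ hlink)

/-- **NO KILL FROM THE LINKED THREE-SHELL CLASS (both cores)** at any rate `c ≤ q c₁`. [ours, calibration] -/
theorem threeShell_symmetricPair_not_kill (hq : 1 ≤ q) (h12 : c₁ < c₂) (hu : Torus.IsSmooth u)
    (hw₂ : Torus.IsSmooth w₂) (hw₃ : Torus.IsSmooth w₃) (hΔu : Torus.laplacian u = -(c₁ • u))
    (hΔ₂ : Torus.laplacian w₂ = -(c₂ • w₂)) (hΔ₃ : Torus.laplacian w₃ = -(c₃ • w₃)) (h : UnitAddTorus d)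
    (hper : (fun y => u (y + h)) = u)
    (hpair₂ : ((fun y => w₂ (y + h)) + fun y => w₂ (y - h)) = (2 * m₂) • w₂)
    (hpair₃ : ((fun y => w₃ (y + h)) + fun y => w₃ (y - h)) = (2 * m₃) • w₃) (hm₂ : m₂ < 1)
    (hlink : (1 - m₂) * (c₃ - c₁) = (1 - m₃) * (c₂ - c₁)) {c : ℝ} (hc : c ≤ q * c₁) :
    ¬ heatDissipation (torusTopEigMoment q) (u + w₂ + w₃) < c * torusTopEigMoment q (u + w₂ + w₃) ∧
      ¬ heatDissipation (torusNegBotEigMoment q) (u + w₂ + w₃) <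
        c * torusNegBotEigMoment q (u + w₂ + w₃) := by
  obtain ⟨k1, k2⟩ :=
    threeShell_symmetricPair_coercive hq h12 hu hw₂ hw₃ hΔu hΔ₂ hΔ₃ h hper hpair₂ hpair₃ hm₂ hlink
  have m1 := mul_le_mul_of_nonneg_right hc (torusTopEigMoment_nonneg q (u + w₂ + w₃))
  have m2' := mul_le_mul_of_nonneg_right hc (torusNegBotEigMoment_nonneg q (u + w₂ + w₃))
  exact ⟨fun hlt => by linarith, fun hlt => by linarith⟩

end ThreeShell

/-! ## 3. The class statements -/

/-- **The calibrated class is heat-coercive at the low-shell rate (`λ₁` core)**: for every real `q ≥ 1` and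
`c₁`, `HeatCoerciveOn {v : ∃ z τ n θ a, Δv = −c₁v − z, τ > 0, θ ≥ 0, ∑θ = 1, ∑ⱼ θⱼ v(· + aⱼ) = v − τz}
(∫(λ₁⁺)^q) (q c₁)`. [ours, calibration] -/
theorem heatCoerciveOn_calibrated_top [Nonempty d] {q : ℝ} (hq : 1 ≤ q) (c₁ : ℝ) :
    HeatCoerciveOn
      (fun v : UnitAddTorus d → EuclideanSpace ℝ d =>
        ∃ (z : UnitAddTorus d → EuclideanSpace ℝ d) (τ : ℝ) (n : ℕ) (θ : Fin n → ℝ)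
          (a : Fin n → UnitAddTorus d), Torus.IsSmooth z ∧ Torus.laplacian v = -(c₁ • v) - z ∧ 0 < τ ∧
          (∀ j, 0 ≤ θ j) ∧ ∑ j, θ j = 1 ∧ (∑ j, θ j • fun y => v (y + a j)) = v + τ • (-z))
      (torusTopEigMoment q) (q * c₁) := by
  rintro - v hv - - ⟨z, τ, n, θ, a, hz, hΔ, hτ, h0, h1, hcal⟩
  exact (calibrated_coercive hq hv hz hΔ (s := Finset.univ) (fun j _ => h0 j) h1 hτ hcal).1

/-- The same for the `−λ₃` core. [ours, calibration] -/
theorem heatCoerciveOn_calibrated_negBot [Nonempty d] {q : ℝ} (hq : 1 ≤ q) (c₁ : ℝ) :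
    HeatCoerciveOn
      (fun v : UnitAddTorus d → EuclideanSpace ℝ d =>
        ∃ (z : UnitAddTorus d → EuclideanSpace ℝ d) (τ : ℝ) (n : ℕ) (θ : Fin n → ℝ)
          (a : Fin n → UnitAddTorus d), Torus.IsSmooth z ∧ Torus.laplacian v = -(c₁ • v) - z ∧ 0 < τ ∧
          (∀ j, 0 ≤ θ j) ∧ ∑ j, θ j = 1 ∧ (∑ j, θ j • fun y => v (y + a j)) = v + τ • (-z))
      (torusNegBotEigMoment q) (q * c₁) := by
  rintro - v hv - - ⟨z, τ, n, θ, a, hz, hΔ, hτ, h0, h1, hcal⟩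
  exact (calibrated_coercive hq hv hz hΔ (s := Finset.univ) (fun j _ => h0 j) h1 hτ hcal).2

/-- **The linked three-shell class is heat-coercive at the low-shell rate (`λ₁` core).** [ours, calibration] -/
theorem heatCoerciveOn_threeShellSymmetricPair_top [Nonempty d] {q : ℝ} (hq : 1 ≤ q) (c₁ : ℝ) :
    HeatCoerciveOn
      (fun v : UnitAddTorus d → EuclideanSpace ℝ d =>
        ∃ (u w₂ w₃ : UnitAddTorus d → EuclideanSpace ℝ d) (c₂ c₃ m₂ m₃ : ℝ) (h : UnitAddTorus d),
          Torus.IsSmooth u ∧ Torus.IsSmooth w₂ ∧ Torus.IsSmooth w₃ ∧ Torus.laplacian u = -(c₁ • u) ∧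
          Torus.laplacian w₂ = -(c₂ • w₂) ∧ Torus.laplacian w₃ = -(c₃ • w₃) ∧ c₁ < c₂ ∧ v = u + w₂ + w₃ ∧
          (fun y => u (y + h)) = u ∧ ((fun y => w₂ (y + h)) + fun y => w₂ (y - h)) = (2 * m₂) • w₂ ∧
          ((fun y => w₃ (y + h)) + fun y => w₃ (y - h)) = (2 * m₃) • w₃ ∧ m₂ < 1 ∧
          (1 - m₂) * (c₃ - c₁) = (1 - m₃) * (c₂ - c₁))
      (torusTopEigMoment q) (q * c₁) := by
  rintro - v - - - ⟨u, w₂, w₃, c₂, c₃, m₂, m₃, h, hu, hw₂, hw₃, hΔu, hΔ₂, hΔ₃, h12, rfl, hper, hp₂, hp₃, hm₂,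
    hlink⟩
  exact (threeShell_symmetricPair_coercive hq h12 hu hw₂ hw₃ hΔu hΔ₂ hΔ₃ h hper hp₂ hp₃ hm₂ hlink).1

/-- The same for the `−λ₃` core. [ours, calibration] -/
theorem heatCoerciveOn_threeShellSymmetricPair_negBot [Nonempty d] {q : ℝ} (hq : 1 ≤ q) (c₁ : ℝ) :
    HeatCoerciveOn
      (fun v : UnitAddTorus d → EuclideanSpace ℝ d =>
        ∃ (u w₂ w₃ : UnitAddTorus d → EuclideanSpace ℝ d) (c₂ c₃ m₂ m₃ : ℝ) (h : UnitAddTorus d),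
          Torus.IsSmooth u ∧ Torus.IsSmooth w₂ ∧ Torus.IsSmooth w₃ ∧ Torus.laplacian u = -(c₁ • u) ∧
          Torus.laplacian w₂ = -(c₂ • w₂) ∧ Torus.laplacian w₃ = -(c₃ • w₃) ∧ c₁ < c₂ ∧ v = u + w₂ + w₃ ∧
          (fun y => u (y + h)) = u ∧ ((fun y => w₂ (y + h)) + fun y => w₂ (y - h)) = (2 * m₂) • w₂ ∧
          ((fun y => w₃ (y + h)) + fun y => w₃ (y - h)) = (2 * m₃) • w₃ ∧ m₂ < 1 ∧
          (1 - m₂) * (c₃ - c₁) = (1 - m₃) * (c₂ - c₁))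
      (torusNegBotEigMoment q) (q * c₁) := by
  rintro - v - - - ⟨u, w₂, w₃, c₂, c₃, m₂, m₃, h, hu, hw₂, hw₃, hΔu, hΔ₂, hΔ₃, h12, rfl, hper, hp₂, hp₃, hm₂,
    hlink⟩
  exact (threeShell_symmetricPair_coercive hq h12 hu hw₂ hw₃ hΔu hΔ₂ hΔ₃ h hper hp₂ hp₃ hm₂ hlink).2

end TopEig

end Summit.NavierStokesRegularity.FunctionalMining

end

-- search for candidate a priori estimates; no regularity claim
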